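import Summits.NavierStokesRegularity.TurbBounds.SpectralFormFreeSlip
import Summits.NavierStokesRegularity.TurbBounds.FSU1.Mode.M01Calculus
import Summits.NavierStokesRegularity.TurbBounds.FSU1.Mode.M03Defs

/-!
# FS-U1″ mode lemma — CouplingRemainder (`TurbBounds/FSU1/Mode/M09CouplingRemainder.lean`)

FS-PROOF-DRAFT §3.7 (ii): the remainder part of the coupling bound — `couplingRemainder : CouplingRemainder`.

Cell-made mathematics of FS-PROOF-DRAFT §3 (pub-turb-sos), kernel-checked; generated from the design compose file
`StageF_compose.check.lean` (96c4b9bf…) by `build_mode_split.py`.  HONEST FRAMING: rigorous bounds for the stated PDE and boundary conditions; no claim about physical turbulence beyond the bound.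
-/

open Real intervalIntegral MeasureTheory Set

namespace Summit.NavierStokesRegularity.TurbBounds.FSU1.Mode

open Summit.NavierStokesRegularity.TurbBounds.SpectralFormFreeSlip

namespace CRem

/-! ### Calculus helpers -/

/-! ### Regularity of `V ∈ C³` (verbatim idiom of the regime-I design) -/

/-! ### The kernel `K` -/

/-- `K(s,t) = cosh k(δ−s) − cosh k(max(s,t) − s)`. -/
noncomputable def K (k δ s t : ℝ) : ℝ := Real.cosh (k * (δ - s)) - Real.cosh (k * (max s t - s))

/-- The coupling kernel for `s ≤ t`: `K(s,t) = cosh k(δ−s) − cosh k(t−s)`. -/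
theorem K_of_le {k δ s t : ℝ} (h : s ≤ t) : K k δ s t = Real.cosh (k * (δ - s)) - Real.cosh (k * (t - s)) := by
  unfold K; rw [max_eq_right h]

/-- The coupling kernel `K(s,t)` for `t ≤ s`. -/
theorem K_of_ge {k δ s t : ℝ} (h : t ≤ s) : K k δ s t = Real.cosh (k * (δ - s)) - 1 := by
  unfold K; rw [max_eq_left h]; simp

/-- The coupling kernel is jointly continuous. -/
theorem continuous_K (k δ : ℝ) : Continuous fun p : ℝ × ℝ => K k δ p.1 p.2 := by
  unfold K
  exact (Real.continuous_cosh.comp (continuous_const.mul (continuous_const.sub continuous_fst))).sub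
    (Real.continuous_cosh.comp (continuous_const.mul ((continuous_fst.max continuous_snd).sub continuous_fst)))

/-- `s ↦ K(s,t)` is continuous. -/
theorem continuous_K_left (k δ t : ℝ) : Continuous fun s => K k δ s t :=
  (continuous_K k δ).comp (continuous_id.prodMk continuous_const)

/-- GREEN: for `0 ≤ t ≤ δ`, `k² ∫_t^δ r = ∫₀^δ K(s,t) (r'' − k² r)(s) ds` when `r(0) = r'(0) = 0`. -/
theorem green_repr {r r' r'' : ℝ → ℝ} (k δ t : ℝ) (ht0 : 0 ≤ t) (htδ : t ≤ δ)
    (hr : ∀ x, HasDerivAt r (r' x) x) (hr' : ∀ x, HasDerivAt r' (r'' x) x) (cr'' : Continuous r'')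
    (h0 : r 0 = 0) (h0' : r' 0 = 0) :
    k ^ 2 * ∫ z in t..δ, r z = ∫ s in (0:ℝ)..δ, K k δ s t * (r'' s - k ^ 2 * r s) := by
  have cr : Continuous r := continuous_iff_continuousAt.2 fun x => (hr x).continuousAt
  -- piece 2 on [t, δ] with ψ₂ = cosh k(δ−s) − 1
  have hψ2 : ∀ x, HasDerivAt (fun s => Real.cosh (k * (δ - s)) - 1) (-k * Real.sinh (k * (δ - x))) x :=
    fun x => (hasDerivAt_cosh_lin k δ x).sub_const 1
  have hψ2' : ∀ x, HasDerivAt (fun s => -k * Real.sinh (k * (δ - s))) (k ^ 2 * Real.cosh (k * (δ - x))) x := by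
    intro x
    have h := (hasDerivAt_sinh_lin k δ x).const_mul (-k)
    have e : -k * (-k * Real.cosh (k * (δ - x))) = k ^ 2 * Real.cosh (k * (δ - x)) := by ring
    rw [e] at h; exact h
  have cψ2'' : Continuous fun x => k ^ 2 * Real.cosh (k * (δ - x)) :=
    continuous_const.mul (Real.continuous_cosh.comp (continuous_const.mul (continuous_const.sub continuous_id)))
  have G2 := green (a := t) (b := δ) k hψ2 hψ2' hr hr' cψ2'' cr''
  -- piece 1 on [0, t] with ψ₁ = cosh k(δ−s) − cosh k(t−s)
  have hψ1 : ∀ x, HasDerivAt (fun s => Real.cosh (k * (δ - s)) - Real.cosh (k * (t - s)))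
      (-k * Real.sinh (k * (δ - x)) - -k * Real.sinh (k * (t - x))) x :=
    fun x => (hasDerivAt_cosh_lin k δ x).sub (hasDerivAt_cosh_lin k t x)
  have hψ1' : ∀ x, HasDerivAt (fun s => -k * Real.sinh (k * (δ - s)) - -k * Real.sinh (k * (t - s)))
      (k ^ 2 * Real.cosh (k * (δ - x)) - k ^ 2 * Real.cosh (k * (t - x))) x := by
    intro x
    have h := ((hasDerivAt_sinh_lin k δ x).const_mul (-k)).sub ((hasDerivAt_sinh_lin k t x).const_mul (-k))
    have e : -k * (-k * Real.cosh (k * (δ - x))) - -k * (-k * Real.cosh (k * (t - x)))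
        = k ^ 2 * Real.cosh (k * (δ - x)) - k ^ 2 * Real.cosh (k * (t - x)) := by ring
    rw [e] at h; exact h
  have cψ1'' : Continuous fun x => k ^ 2 * Real.cosh (k * (δ - x)) - k ^ 2 * Real.cosh (k * (t - x)) :=
    (continuous_const.mul (Real.continuous_cosh.comp (continuous_const.mul (continuous_const.sub continuous_id)))).sub
      (continuous_const.mul (Real.continuous_cosh.comp (continuous_const.mul (continuous_const.sub continuous_id))))
  have G1 := green (a := 0) (b := t) k hψ1 hψ1' hr hr' cψ1'' cr''
  -- simplify the two Green identities
  have z1 : ∫ x in (0:ℝ)..t, r x * ((k ^ 2 * Real.cosh (k * (δ - x)) - k ^ 2 * Real.cosh (k * (t - x)))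
      - k ^ 2 * (Real.cosh (k * (δ - x)) - Real.cosh (k * (t - x)))) = 0 := by
    have : (fun x => r x * ((k ^ 2 * Real.cosh (k * (δ - x)) - k ^ 2 * Real.cosh (k * (t - x)))
      - k ^ 2 * (Real.cosh (k * (δ - x)) - Real.cosh (k * (t - x))))) = fun _ => (0:ℝ) := by
      funext x; ring
    rw [this]; simp
  have z2 : ∫ x in t..δ, r x * (k ^ 2 * Real.cosh (k * (δ - x)) - k ^ 2 * (Real.cosh (k * (δ - x)) - 1))
      = k ^ 2 * ∫ x in t..δ, r x := by
    have : (fun x => r x * (k ^ 2 * Real.cosh (k * (δ - x)) - k ^ 2 * (Real.cosh (k * (δ - x)) - 1)))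
        = fun x => k ^ 2 * r x := by
      funext x; ring
    rw [this, intervalIntegral.integral_const_mul]
  rw [z1] at G1
  rw [z2] at G2
  simp only [h0, h0', sub_self, mul_zero, Real.sinh_zero, Real.cosh_zero, sub_zero, add_zero] at G1 G2
  -- split ∫₀^δ K · f at t and identify the pieces
  have cf : Continuous fun s => r'' s - k ^ 2 * r s := cr''.sub (continuous_const.mul cr)
  have Ipc : ∀ a b, IntervalIntegrable (fun s => K k δ s t * (r'' s - k ^ 2 * r s)) volume a b :=
    fun a b => ((continuous_K_left k δ t).mul cf).intervalIntegrable _ _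
  rw [← intervalIntegral.integral_add_adjacent_intervals (Ipc 0 t) (Ipc t δ)]
  have p1 : ∫ s in (0:ℝ)..t, K k δ s t * (r'' s - k ^ 2 * r s)
      = ∫ s in (0:ℝ)..t, (Real.cosh (k * (δ - s)) - Real.cosh (k * (t - s))) * (r'' s - k ^ 2 * r s) := by
    apply intervalIntegral.integral_congr
    intro s hs
    rw [uIcc_of_le ht0] at hs
    simp only [K_of_le hs.2]
  have p2 : ∫ s in t..δ, K k δ s t * (r'' s - k ^ 2 * r s)
      = ∫ s in t..δ, (Real.cosh (k * (δ - s)) - 1) * (r'' s - k ^ 2 * r s) := by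
    apply intervalIntegral.integral_congr
    intro s hs
    rw [uIcc_of_le htδ] at hs
    simp only [K_of_ge hs.1]
  rw [p1, p2, G1, G2]
  ring

/-- The kernel double integral: `∫₀^δ∫₀^δ K(s,t)² ds dt = δ² J(kδ)` (substitution + Fubini). -/
theorem kernel_sq_integral (k δ : ℝ) (hδ : 0 < δ) :
    ∫ t in (0:ℝ)..δ, ∫ s in (0:ℝ)..δ, K k δ s t ^ 2 = δ ^ 2 * Jfun (k * δ) := by
  have hδ0 : δ ≠ 0 := hδ.ne'
  -- inner substitution s = δσ
  have inner : ∀ t, ∫ s in (0:ℝ)..δ, K k δ s t ^ 2 = δ * ∫ σ in (0:ℝ)..1, K k δ (δ * σ) t ^ 2 := by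
    intro t
    have h := intervalIntegral.integral_comp_mul_left (a := 0) (b := 1) (fun s => K k δ s t ^ 2) hδ0
    simp only [mul_zero, mul_one, smul_eq_mul] at h
    rw [h]; field_simp
  simp_rw [inner]
  rw [intervalIntegral.integral_const_mul]
  -- outer substitution t = δu
  have h := intervalIntegral.integral_comp_mul_left (a := 0) (b := 1)
    (fun t => ∫ σ in (0:ℝ)..1, K k δ (δ * σ) t ^ 2) hδ0
  simp only [mul_zero, mul_one, smul_eq_mul] at h
  have outer : ∫ t in (0:ℝ)..δ, ∫ σ in (0:ℝ)..1, K k δ (δ * σ) t ^ 2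
      = δ * ∫ u in (0:ℝ)..1, ∫ σ in (0:ℝ)..1, K k δ (δ * σ) (δ * u) ^ 2 := by
    rw [h]; field_simp
  rw [outer]
  -- identify the integrand with J's and swap the order
  have hKs : ∀ σ u, K k δ (δ * σ) (δ * u) = Real.cosh (k * δ * (1 - σ)) - Real.cosh (k * δ * (max σ u - σ)) := by
    intro σ u
    unfold K
    rw [← mul_max_of_nonneg σ u hδ.le]
    have e1 : k * (δ - δ * σ) = k * δ * (1 - σ) := by ring
    have e2 : k * (δ * max σ u - δ * σ) = k * δ * (max σ u - σ) := by ring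
    rw [e1, e2]
  simp_rw [hKs]
  have cJ : Continuous (Function.uncurry fun (u σ : ℝ) =>
      (Real.cosh (k * δ * (1 - σ)) - Real.cosh (k * δ * (max σ u - σ))) ^ 2) := by
    have : Continuous fun p : ℝ × ℝ =>
        (Real.cosh (k * δ * (1 - p.2)) - Real.cosh (k * δ * (max p.2 p.1 - p.2))) ^ 2 :=
      ((Real.continuous_cosh.comp (continuous_const.mul (continuous_const.sub continuous_snd))).sub
        (Real.continuous_cosh.comp (continuous_const.mul ((continuous_snd.max continuous_fst).sub
          continuous_snd)))).pow 2
    exact this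
  -- Fubini on a rectangle for a jointly continuous integrand, as a LOCAL `have` (proof script of the former M01 lemma
  -- verbatim): a stand-alone copy of this folklore lemma is already in the tree (dedup policy, LEAD decision 120 (C)).
  have swap_cont : ∀ {F : ℝ → ℝ → ℝ}, Continuous (Function.uncurry F) → ∀ {a b c d : ℝ}, a ≤ b → c ≤ d →
      ∫ x in a..b, ∫ y in c..d, F x y = ∫ y in c..d, ∫ x in a..b, F x y := by
    intro F hF a b c d hab hcd
    apply MeasureTheory.intervalIntegral_intervalIntegral_swap
    have h : IntegrableOn (Function.uncurry F) (Icc a b ×ˢ Icc c d) volume :=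
      (hF.continuousOn).integrableOn_compact (isCompact_Icc.prod isCompact_Icc)
    refine h.mono_set ?_
    rw [uIoc_of_le hab, uIoc_of_le hcd]
    exact Set.prod_mono Ioc_subset_Icc_self Ioc_subset_Icc_self
  rw [swap_cont cJ zero_le_one zero_le_one]
  unfold Jfun
  ring

end CRem

open CRem in
/-- FS-PROOF-DRAFT §3.7 (ii), PROVED: `|(1/δ)∫₀^δ (V − (V′(0)/k) sinh kz)·Θ| ≤ (√J(kδ)/k)·‖Ω‖_{L²(0,δ)}·‖Θ′‖_{L²(0,δ)}` (`Ω = vort k V`, `V ∈ C³`, `V(0) = 0`, `Θ ∈ C¹`, `Θ(0) = 0`), by the kernel representation and Cauchy–Schwarz. -/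
theorem couplingRemainder : CouplingRemainder := by
  intro δ k V Θ hδ hk hV hV0 hΘ hΘ0
  have hk0 : k ≠ 0 := hk.ne'
  have hδ0 : δ ≠ 0 := hδ.ne'
  -- regularity
  have hVd : ∀ x, HasDerivAt V (deriv V x) x := fun x => (hV.differentiable (by norm_num) x).hasDerivAt
  have hV'd : ∀ x, HasDerivAt (deriv V) (deriv (deriv V) x) x :=
    fun x => ((contDiff_two_deriv hV).differentiable (by norm_num) x).hasDerivAt
  have cV'' : Continuous (deriv (deriv V)) := (contDiff_one_deriv_deriv hV).continuous
  have hΘd : ∀ x, HasDerivAt Θ (deriv Θ x) x := fun x => (hΘ.differentiable (by norm_num) x).hasDerivAt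
  have cΘ' : Continuous (deriv Θ) := hΘ.continuous_deriv le_rfl
  -- r, r', r''
  set S := deriv V 0 with hS
  have hrd : ∀ x, HasDerivAt (fun z => V z - S / k * Real.sinh (k * z)) (deriv V x - S * Real.cosh (k * x)) x := by
    intro x
    have h := (hVd x).sub ((hasDerivAt_sinh_mul k x).const_mul (S / k))
    have e : deriv V x - S / k * (k * Real.cosh (k * x)) = deriv V x - S * Real.cosh (k * x) := by
      field_simp
    rw [e] at h; exact h
  have hr'd : ∀ x, HasDerivAt (fun z => deriv V z - S * Real.cosh (k * z))
      (deriv (deriv V) x - S * k * Real.sinh (k * x)) x := by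
    intro x
    have h := (hV'd x).sub ((hasDerivAt_cosh_mul k x).const_mul S)
    have e : deriv (deriv V) x - S * (k * Real.sinh (k * x)) = deriv (deriv V) x - S * k * Real.sinh (k * x) := by
      ring
    rw [e] at h; exact h
  have cr'' : Continuous fun x => deriv (deriv V) x - S * k * Real.sinh (k * x) :=
    cV''.sub (continuous_const.mul (Real.continuous_sinh.comp (continuous_const.mul continuous_id)))
  have cr : Continuous fun z => V z - S / k * Real.sinh (k * z) :=
    continuous_iff_continuousAt.2 fun x => (hrd x).continuousAt
  have hr0 : (fun z => V z - S / k * Real.sinh (k * z)) 0 = 0 := by simp [hV0]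
  have hr0' : (fun z => deriv V z - S * Real.cosh (k * z)) 0 = 0 := by simp [hS]
  -- the ODE: r'' − k² r = k Ω
  have hode : ∀ s, (deriv (deriv V) s - S * k * Real.sinh (k * s)) - k ^ 2 * (V s - S / k * Real.sinh (k * s))
      = k * vort k V s := by
    intro s; unfold vort; field_simp; ring
  have cΩ : Continuous (vort k V) := by
    have : Continuous fun s => (deriv (deriv V) s - k ^ 2 * V s) / k :=
      (cV''.sub (continuous_const.mul hV.continuous)).div_const k
    exact this
  -- A(t) = ∫_t^δ r, its derivative and continuity
  set A : ℝ → ℝ := fun t => ∫ z in t..δ, (V z - S / k * Real.sinh (k * z)) with hA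
  have hP : ∀ t, HasDerivAt (fun u => ∫ z in δ..u, (V z - S / k * Real.sinh (k * z)))
      (V t - S / k * Real.sinh (k * t)) t :=
    fun t => (cr.integral_hasStrictDerivAt δ t).hasDerivAt
  have hAP : ∀ u, A u = -∫ z in δ..u, (V z - S / k * Real.sinh (k * z)) := by
    intro u; rw [hA]; simp only [intervalIntegral.integral_symm u δ, neg_neg]
  have hnegA : ∀ t, HasDerivAt (fun u => -A u) (V t - S / k * Real.sinh (k * t)) t := by
    intro t
    have e : (fun u => -A u) = fun u => ∫ z in δ..u, (V z - S / k * Real.sinh (k * z)) := by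
      funext u; rw [hAP u, neg_neg]
    rw [e]; exact hP t
  have cA : Continuous A := by
    have e : A = fun u => -∫ z in δ..u, (V z - S / k * Real.sinh (k * z)) := funext hAP
    rw [e]; exact (continuous_iff_continuousAt.2 fun x => (hP x).continuousAt).neg
  -- Step 1: ∫ rΘ = ∫ Θ' A
  have step1 : ∫ z in (0:ℝ)..δ, (V z - S / k * Real.sinh (k * z)) * Θ z = ∫ t in (0:ℝ)..δ, deriv Θ t * A t := by
    have ibp := intervalIntegral.integral_mul_deriv_eq_deriv_mul (a := 0) (b := δ)
      (fun x _ => hΘd x) (fun x _ => hnegA x) (cΘ'.intervalIntegrable _ _) (cr.intervalIntegrable _ _)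
    have e1 : (fun z => (V z - S / k * Real.sinh (k * z)) * Θ z) = fun z => Θ z * (V z - S / k * Real.sinh (k * z)) := by
      funext z; ring
    have hAδ : A δ = 0 := by rw [hA]; simp
    rw [e1, ibp, hΘ0, hAδ]
    simp only [neg_zero, mul_zero, zero_mul, sub_zero, zero_sub]
    rw [← intervalIntegral.integral_neg]
    congr 1; funext x; ring
  -- Step 2: A t = (1/k) ∫ K Ω on [0, δ]
  have step2 : ∀ t ∈ Icc (0:ℝ) δ, A t = 1 / k * ∫ s in (0:ℝ)..δ, K k δ s t * vort k V s := by
    intro t ht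
    have g := green_repr k δ t ht.1 ht.2 hrd hr'd cr'' hr0 hr0'
    simp_rw [hode] at g
    have e : ∫ s in (0:ℝ)..δ, K k δ s t * (k * vort k V s) = k * ∫ s in (0:ℝ)..δ, K k δ s t * vort k V s := by
      rw [← intervalIntegral.integral_const_mul]; congr 1; funext s; ring
    rw [e] at g
    -- g : k^2 * A t = k * ∫ …
    have g' : k * (k * A t) = k * ∫ s in (0:ℝ)..δ, K k δ s t * vort k V s := by rw [← g, hA]; ring
    have g'' := mul_left_cancel₀ hk0 g'
    field_simp; linarith [g'']
  -- Step 3: Cauchy–Schwarz twice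
  have cs1 := abs_integral_mul_le hδ.le cΘ' cA
  have hA2 : ∀ t ∈ Icc (0:ℝ) δ, A t ^ 2 ≤ 1 / k ^ 2 * (∫ s in (0:ℝ)..δ, vort k V s ^ 2) * ∫ s in (0:ℝ)..δ, K k δ s t ^ 2 := by
    intro t ht
    rw [step2 t ht]
    have h := integral_mul_sq_le hδ.le (continuous_K_left k δ t) cΩ
    have e : (1 / k * ∫ s in (0:ℝ)..δ, K k δ s t * vort k V s) ^ 2
        = 1 / k ^ 2 * (∫ s in (0:ℝ)..δ, K k δ s t * vort k V s) ^ 2 := by ring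
    rw [e]
    have hk2 : 0 < 1 / k ^ 2 := by positivity
    calc 1 / k ^ 2 * (∫ s in (0:ℝ)..δ, K k δ s t * vort k V s) ^ 2
        ≤ 1 / k ^ 2 * ((∫ s in (0:ℝ)..δ, K k δ s t ^ 2) * ∫ s in (0:ℝ)..δ, vort k V s ^ 2) :=
          mul_le_mul_of_nonneg_left h hk2.le
      _ = 1 / k ^ 2 * (∫ s in (0:ℝ)..δ, vort k V s ^ 2) * ∫ s in (0:ℝ)..δ, K k δ s t ^ 2 := by ring
  have cKK : Continuous fun t => ∫ s in (0:ℝ)..δ, K k δ s t ^ 2 := by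
    have cu : Continuous (Function.uncurry fun (t s : ℝ) => K k δ s t ^ 2) := by
      have : Continuous fun p : ℝ × ℝ => K k δ p.2 p.1 ^ 2 :=
        ((continuous_K k δ).comp continuous_swap).pow 2
      exact this
    exact intervalIntegral.continuous_parametric_intervalIntegral_of_continuous' cu 0 δ
  have intA2 : ∫ t in (0:ℝ)..δ, A t ^ 2
      ≤ ∫ t in (0:ℝ)..δ, 1 / k ^ 2 * (∫ s in (0:ℝ)..δ, vort k V s ^ 2) * ∫ s in (0:ℝ)..δ, K k δ s t ^ 2 := by
    apply intervalIntegral.integral_mono_on hδ.le ((cA.pow 2).intervalIntegrable _ _)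
      ((continuous_const.mul cKK).intervalIntegrable _ _)
    exact hA2
  rw [intervalIntegral.integral_const_mul, kernel_sq_integral k δ hδ] at intA2
  -- intA2 : ∫ A² ≤ 1/k² * ∫Ω² * (δ² J)
  have hΩ2 : 0 ≤ ∫ s in (0:ℝ)..δ, vort k V s ^ 2 := intervalIntegral.integral_nonneg hδ.le (fun s _ => sq_nonneg _)
  have hΘ2 : 0 ≤ ∫ t in (0:ℝ)..δ, deriv Θ t ^ 2 := intervalIntegral.integral_nonneg hδ.le (fun s _ => sq_nonneg _)
  have hJ0 : 0 ≤ Jfun (k * δ) := by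
    have : 0 ≤ δ ^ 2 * Jfun (k * δ) := by
      rw [← kernel_sq_integral k δ hδ]
      exact intervalIntegral.integral_nonneg hδ.le (fun t _ =>
        intervalIntegral.integral_nonneg hδ.le (fun s _ => sq_nonneg _))
    exact (mul_nonneg_iff_of_pos_left (by positivity)).mp this
  have sqA : Real.sqrt (∫ t in (0:ℝ)..δ, A t ^ 2)
      ≤ δ / k * Real.sqrt (Jfun (k * δ)) * Real.sqrt (∫ s in (0:ℝ)..δ, vort k V s ^ 2) := by
    have h := Real.sqrt_le_sqrt intA2
    have e : 1 / k ^ 2 * (∫ s in (0:ℝ)..δ, vort k V s ^ 2) * (δ ^ 2 * Jfun (k * δ))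
        = (δ / k) ^ 2 * (Jfun (k * δ) * ∫ s in (0:ℝ)..δ, vort k V s ^ 2) := by ring
    rw [e, Real.sqrt_mul (sq_nonneg _), Real.sqrt_sq (by positivity), Real.sqrt_mul hJ0] at h
    linarith [h]
  -- assemble
  rw [step1, abs_mul, abs_of_pos (one_div_pos.mpr hδ)]
  have hT0 : 0 ≤ Real.sqrt (∫ t in (0:ℝ)..δ, deriv Θ t ^ 2) := Real.sqrt_nonneg _
  calc 1 / δ * |∫ t in (0:ℝ)..δ, deriv Θ t * A t|
      ≤ 1 / δ * (Real.sqrt (∫ t in (0:ℝ)..δ, deriv Θ t ^ 2) * Real.sqrt (∫ t in (0:ℝ)..δ, A t ^ 2)) :=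
        mul_le_mul_of_nonneg_left cs1 (by positivity)
    _ ≤ 1 / δ * (Real.sqrt (∫ t in (0:ℝ)..δ, deriv Θ t ^ 2)
          * (δ / k * Real.sqrt (Jfun (k * δ)) * Real.sqrt (∫ s in (0:ℝ)..δ, vort k V s ^ 2))) := by
        apply mul_le_mul_of_nonneg_left _ (by positivity)
        exact mul_le_mul_of_nonneg_left sqA hT0
    _ = Real.sqrt (Jfun (k * δ)) / k * Real.sqrt (∫ z in (0:ℝ)..δ, vort k V z ^ 2)
          * Real.sqrt (∫ z in (0:ℝ)..δ, deriv Θ z ^ 2) := by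
        field_simp

end Summit.NavierStokesRegularity.TurbBounds.FSU1.Mode
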